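import Summits.CriticalPhenomena.CardyFormulaZ2.Theorems.CardyUniqueLimitCardyRigidityDefs
import Summits.CriticalPhenomena.CardyFormulaZ2.Theorems.CardyBoundaryCoulombGasHalfPlaneMarkDensityLawRigidity
import Summits.CriticalPhenomena.CardyFormulaZ2.Theorems.CardyBoundaryCoulombGasHalfPlaneMarkDensityLawGapClosing

/-!
# Stub `stub_kernelFacts` of line `crossing_martingale`
# (crux `CardyRigidity`, stmt-CriticalPhenomena-0746)

The three KERNEL FACTS about a function `f` satisfying the all-rectangle hypothesis
`AllRectangleKernel f` (the bond-`ℤ²` crossing probabilities of every conformal rectangle converge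
to `f` of the cross-ratio): `f` is continuous on `(0,1)`, `f(0⁺) = 0` and `f(1⁻) = 1`.

Proof.  Let `P_n(a,b,c,y) = P_{1/2}[[⌊an⌋,⌊bn⌋]×{0} ↔ [⌊cn⌋,⌊yn⌋]×{0} in ℤ×ℕ]` and let `G` be a
joint subsequential limit of `P_n` along a strictly increasing `θ` (precompactness,
`Subseq.exists_jointSubseqLimit`).  IDENTIFICATION (`KernelFacts.apply_crossRatio_eq`, the box
exhaustion of `Rigidity.eqOn_cardyFunction_of_collinearCardy` run with `G` in place of `F ∘ η`):
for every strictly increasing `p` with `|pᵢ| ≤ 1/4`, `f (η(p)) = G(p)` — the Schwarz–Christoffel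
box `R_t` with prevertices `t·p` has `bondDomainCrossingProb R_t (t/θₙ) → f (η p)`, and the lattice
sandwich `bondDomainCrossingProb R_t (t/n) ≤ P_n(m(t))`,
`P_n(m(t) + ε'e) ≤ bondDomainCrossingProb R_t (t/n) + C L^{-α}` (lattice marks
`mᵢ(t) = G_{SC}(t pᵢ)/t → pᵢ`) passes to the limit along `θ`; continuity of `G` on the chamber
(`Subseq.continuousOn_of_jointLimit`) closes the `ε`-bookkeeping.  Hence
`f x = G(−1/4, −g(x), g(x), 1/4)` on `(0,1)` with `g(x) = (1 − √x)/(4(1 + √x))`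
(`Rigidity.crossRatio_symm`), and the three facts follow from the a priori structure of joint
limits: continuity on the chamber; `0 ≤ G ≤ C((b−a)/(c−a))^α` (`Subseq.jointLimit_le_small_source`,
with `g → 1/4` as `x → 0⁺`); translation invariance + monotonicity
`G(−1/8, 0, 2g, 1/4) ≤ G(−1/4+g, 0, 2g, 1/4+g) = f x ≤ 1` and `G(a,b,c,y) → 1` as `c ↓ b`
(`GapClose.stub_jointLimit_tendsto_one`, with `g → 0⁺` as `x → 1⁻`).
-/

noncomputable section

open MeasureTheory Filter Set Topology Metric
open scoped NNReal ENNReal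
open Literature.Probability.RandomPlanarGeometry
open Literature.Probability.LatticeModels
open Literature.Probability.Percolation hiding cardyFunction
open Summit.CriticalPhenomena.CardyFormulaZ2.Cruxes.HalfPlaneMarkDensityLaw.SketchLine
open Summit.CriticalPhenomena.CardyFormulaZ2.Theorems.HalfPlaneMarkDensityLaw.Negative

namespace Summit.CriticalPhenomena.CardyFormulaZ2.Cruxes.CardyRigidity.CrossingMartingale

namespace KernelFacts

section Limit

variable {θ : ℕ → ℕ} {G : ℝ → ℝ → ℝ → ℝ → ℝ}
  (hG : ∀ a b c y : ℝ, a < b → b < c → c < y →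
    Tendsto (fun n ↦ μ.real (openCrossing halfPlane (arcA a b (θ n))
      (rowIcc ⌊c * (θ n : ℕ)⌋ ⌊y * (θ n : ℕ)⌋))) atTop (𝓝 (G a b c y)))
include hG

/-- Uniform closeness of a joint subsequential limit near a chamber point (its continuity on the
chamber, in `ε`–`δ` form with componentwise distances). [folklore] -/
theorem exists_near (hθ : StrictMono θ) {a b c y : ℝ} (hab : a < b) (hbc : b < c) (hcy : c < y)
    {ε : ℝ} (hε : 0 < ε) :
    ∃ δ > 0, ∀ a' b' c' y' : ℝ, a' < b' → b' < c' → c' < y' → |a' - a| < δ → |b' - b| < δ →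
      |c' - c| < δ → |y' - y| < δ → |G a' b' c' y' - G a b c y| < ε := by
  have hcont := Subseq.continuousOn_of_jointLimit hG hθ
  obtain ⟨δ, hδ, h⟩ := (Metric.continuousOn_iff.1 hcont) (a, b, c, y) ⟨hab, hbc, hcy⟩ ε hε
  refine ⟨δ, hδ, fun a' b' c' y' hab' hbc' hcy' ha hb hc hy ↦ ?_⟩
  have := h (a', b', c', y') ⟨hab', hbc', hcy'⟩ (by
    simp only [Prod.dist_eq, Real.dist_eq]
    exact max_lt ha (max_lt hb (max_lt hc hy)))
  rwa [Real.dist_eq] at this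

set_option maxHeartbeats 400000 in
/-- **Identification of the kernel with the joint half-plane limit.** If `f` is a crossing limit of
bond-`ℤ²` for every conformal rectangle and `G` is a joint subsequential limit of the half-plane
crossing function along a strictly increasing `θ`, then `f (η(p)) = G(p₀,p₁,p₂,p₃)` for every
strictly increasing `p` with `|pᵢ| ≤ 1/4` (box exhaustion run backwards, read along `θ`).
[folklore] -/
theorem apply_crossRatio_eq (hθ : StrictMono θ) {f : ℝ → ℝ} (hf : AllRectangleKernel f)
    {p : Fin 4 → ℝ} (hp : StrictMono p) (hp4 : ∀ i, |p i| ≤ 1 / 4) :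
    f (crossRatio p) = G (p 0) (p 1) (p 2) (p 3) := by
  /- Step 0: the Schwarz–Christoffel box, its boundary map `Φ`, constants. -/
  obtain ⟨K, H, hK, hH, -, hbox⟩ := BoxExhaustion.exists_scBox
  set Φ : ℝ → ℝ := ellipticF ((1 / 2 : ℝ) ^ 2) with hΦ
  have hΦ0 : Φ 0 = 0 := ellipticF_zero _
  have hΦd : HasDerivAt Φ 1 0 := BoxExhaustion.hasDerivAt_ellipticF_zero
  obtain ⟨C₀, α, -, hα, hesc⟩ := exists_real_boxToFar_le_rpow_of_le_half
  have hp01 := hp (show (0 : Fin 4) < 1 by decide)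
  have hp12 := hp (show (1 : Fin 4) < 2 by decide)
  have hp23 := hp (show (2 : Fin 4) < 3 by decide)
  set d : ℝ := min (min (p 1 - p 0) (p 2 - p 1)) (p 3 - p 2) with hd
  have hd0 : 0 < d := lt_min (lt_min (by linarith) (by linarith)) (by linarith)
  have hd1 : d ≤ p 1 - p 0 := (min_le_left _ _).trans (min_le_left _ _)
  have hd2 : d ≤ p 2 - p 1 := (min_le_left _ _).trans (min_le_right _ _)
  have hd3 : d ≤ p 3 - p 2 := min_le_right _ _
  have hdhalf : d ≤ 1 / 2 := by
    have h0 := hp4 0; have h1 := hp4 1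
    rw [abs_le] at h0 h1
    linarith [h0.1, h1.2]
  set κ : ℝ := min (min K H / 9) 1 with hκ
  have hκ0 : 0 < κ := lt_min (by positivity) one_pos
  have hκ1 : κ ≤ 1 := min_le_right _ _
  have hκKH : 9 * κ ≤ min K H := by
    have := min_le_left (min K H / 9) 1; rw [← hκ] at this; linarith
  have hκK : 9 * κ ≤ K := hκKH.trans (min_le_left _ _)
  have hκH : 9 * κ ≤ H := hκKH.trans (min_le_right _ _)
  -- the lattice marks at scale `t`
  set m : ℝ → Fin 4 → ℝ := fun t i ↦ Φ (t * p i) / t with hm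
  have hm_mul : ∀ t, 0 < t → ∀ i, t * m t i = Φ (t * p i) := fun t ht i ↦ by
    simp only [hm]; rw [mul_div_cancel₀ _ ht.ne']
  /- Step 1: `|f x₀ - G p| ≤ ε` for every `ε > 0`; the slack `ε'` and the radius `ρ`. -/
  refine eq_of_forall_dist_le fun ε hε ↦ ?_
  rw [Real.dist_eq]
  obtain ⟨δ₁, hδ₁, hnear⟩ := exists_near hG hθ hp01 hp12 hp23 (show (0 : ℝ) < ε / 3 by positivity)
  obtain ⟨ε', hε'0, hε'd, hε'δ⟩ : ∃ ε' : ℝ, 0 < ε' ∧ ε' < d ∧ ε' < δ₁ / 2 :=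
    ⟨min (d / 2) (δ₁ / 4), lt_min (by positivity) (by positivity),
      (min_le_left _ _).trans_lt (by linarith), (min_le_right _ _).trans_lt (by linarith)⟩
  have hε'1 : ε' ≤ 1 := by linarith
  set ρ : ℝ := min (min (δ₁ / 2) ((d - ε') / 2)) 1 with hρ
  have hρ0 : 0 < ρ := lt_min (lt_min (by positivity) (by linarith)) one_pos
  have hρδ : ρ ≤ δ₁ / 2 := (min_le_left _ _).trans (min_le_left _ _)
  have hρd : ρ ≤ (d - ε') / 2 := (min_le_left _ _).trans (min_le_right _ _)
  have hρ1 : ρ ≤ 1 := min_le_right _ _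
  -- the marks are eventually `ρ`-close to `p`
  have hclose : ∀ᶠ t in 𝓝[>] (0 : ℝ), ∀ i, |m t i - p i| < ρ := by
    refine eventually_all.2 fun i ↦ ?_
    have h1 := Metric.tendsto_nhds.1 (Rigidity.tendsto_div_of_hasDerivAt hΦ0 hΦd (p i)) ρ hρ0
    filter_upwards [h1] with t ht
    rwa [Real.dist_eq] at ht
  /- Step 2: choose the annulus parameter `L` (and with it the scale `t = κ/L`). -/
  have hevL : ∀ᶠ L : ℕ in atTop, (∀ i, |m (κ / L) i - p i| < ρ) ∧
      (C₀ * ((L : ℝ)⁻¹) ^ α < ε / 3 ∧ 1 ≤ L) :=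
    ((BoxExhaustion.tendsto_div_nat_nhdsWithin hκ0).eventually hclose).and
      (((BoxExhaustion.tendsto_const_mul_inv_rpow C₀ hα).eventually
        (eventually_lt_nhds (show (0 : ℝ) < ε / 3 by positivity))).and (eventually_ge_atTop 1))
  obtain ⟨L, hcl, hL3, hL⟩ := hevL.exists
  set t : ℝ := κ / L with ht
  have hLpos : (0 : ℝ) < L := by exact_mod_cast hL
  have hL1r : (1 : ℝ) ≤ L := by exact_mod_cast hL
  have ht0 : 0 < t := div_pos hκ0 hLpos
  have htκ : t ≤ κ := div_le_self hκ0.le hL1r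
  have ht1 : t ≤ 1 := htκ.trans hκ1
  have htL : t * L = κ := div_mul_cancel₀ κ hLpos.ne'
  -- consequences of the closeness of the marks
  have hc0 := hcl 0; have hc1 := hcl 1; have hc2 := hcl 2; have hc3 := hcl 3
  rw [abs_lt] at hc0 hc1 hc2 hc3
  have hgap1 : ε' < m t 1 - m t 0 := by linarith [hc0.2, hc1.1]
  have hgap12 : ε' < m t 2 - m t 1 := by linarith [hc1.2, hc2.1]
  have hgap2 : ε' < m t 3 - m t 2 := by linarith [hc2.2, hc3.1]
  have hm01 : m t 0 < m t 1 := by linarith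
  have hm12 : m t 1 < m t 2 := by linarith
  have hm23 : m t 2 < m t 3 := by linarith
  have hbd : ∀ i, |m t i| < 2 := fun i ↦ by
    have h1 := hcl i
    have h2 := hp4 i
    have h3 := abs_sub_abs_le_abs_sub (m t i) (p i)
    linarith
  have hGlo : |G (m t 0) (m t 1) (m t 2) (m t 3) - G (p 0) (p 1) (p 2) (p 3)| < ε / 3 :=
    hnear _ _ _ _ hm01 hm12 hm23 (abs_lt.2 ⟨by linarith [hc0.1], by linarith [hc0.2]⟩)
      (abs_lt.2 ⟨by linarith [hc1.1], by linarith [hc1.2]⟩)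
      (abs_lt.2 ⟨by linarith [hc2.1], by linarith [hc2.2]⟩)
      (abs_lt.2 ⟨by linarith [hc3.1], by linarith [hc3.2]⟩)
  have hGhi : |G (m t 0 + ε') (m t 1) (m t 2 + ε') (m t 3) - G (p 0) (p 1) (p 2) (p 3)| < ε / 3 :=
    hnear _ _ _ _ (by linarith) (by linarith) (by linarith)
      (abs_lt.2 ⟨by linarith [hc0.1], by linarith [hc0.2]⟩)
      (abs_lt.2 ⟨by linarith [hc1.1], by linarith [hc1.2]⟩)
      (abs_lt.2 ⟨by linarith [hc2.1], by linarith [hc2.2]⟩)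
      (abs_lt.2 ⟨by linarith [hc3.1], by linarith [hc3.2]⟩)
  /- Step 3: the box at scale `t` and its limit `f x₀`, read along `θ`. -/
  have hu_mono : StrictMono (fun i ↦ t * p i) := fun i j hij ↦ mul_lt_mul_of_pos_left (hp hij) ht0
  have hu_mem : ∀ i, t * p i ∈ Ioo (-1 : ℝ) 1 := fun i ↦ by
    have h1 : |t * p i| ≤ t * (1 / 4) := by
      rw [abs_mul, abs_of_pos ht0]; exact mul_le_mul_of_nonneg_left (hp4 i) ht0.le
    rw [abs_le] at h1
    constructor <;> linarith [h1.1, h1.2]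
  obtain ⟨R, hRc, hR0, hR2, φ, hφ⟩ := hbox (fun i ↦ t * p i) hu_mono hu_mem
  have hcrt : crossRatio (fun i ↦ t * p i) = crossRatio p := by
    have := crossRatio_affine p ht0.ne' 0
    simp only [add_zero] at this
    exact this
  have hboxlim : Tendsto (fun n : ℕ ↦ bondDomainCrossingProb R (t / (θ n : ℕ))) atTop
      (𝓝 (f (crossRatio p))) := by
    have := hf R φ _ hφ
    rw [hcrt] at this
    exact (BoxExhaustion.tendsto_comp_div_nat ht0 this).comp hθ.tendsto_atTop
  have hR0' : R.arc 0 = {z : ℂ | z.im = 0 ∧ z.re ∈ Icc (t * m t 0) (t * m t 1)} := by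
    rw [hR0, hm_mul t ht0 0, hm_mul t ht0 1]
  have hR2' : R.arc 2 = {z : ℂ | z.im = 0 ∧ z.re ∈ Icc (t * m t 2) (t * m t 3)} := by
    rw [hR2, hm_mul t ht0 2, hm_mul t ht0 3]
  /- Step 4: the two half-plane limits along `θ`. -/
  have hPlo := hG _ _ _ _ hm01 hm12 hm23
  have hPhi : Tendsto (fun n : ℕ ↦ μ.real (openCrossing halfPlane (arcA (m t 0 + ε') (m t 1) (θ n))
      (rowIcc ⌊(m t 2 + ε') * (θ n : ℕ)⌋ ⌊m t 3 * (θ n : ℕ)⌋))) atTop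
      (𝓝 (G (m t 0 + ε') (m t 1) (m t 2 + ε') (m t 3))) :=
    hG _ _ _ _ (by linarith) (by linarith) (by linarith)
  /- Step 5: the lattice sandwich for all large `n`. -/
  set M₀ : ℕ := ⌈|m t 0 + ε'|⌉₊ + ⌈|m t 1|⌉₊ + 1 with hM₀
  have hM₀1 : 1 ≤ M₀ := by omega
  have hb0 : |m t 0| < 3 := by linarith [hbd 0]
  have hb1 : |m t 1| < 3 := by linarith [hbd 1]
  have hb2 : |m t 2| < 3 := by linarith [hbd 2]
  have hb3 : |m t 3| < 3 := by linarith [hbd 3]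
  have hb0' : |m t 0 + ε'| < 3 := by
    have := abs_add_le (m t 0) ε'; rw [abs_of_pos hε'0] at this; linarith [hbd 0]
  have hb2' : |m t 2 + ε'| < 3 := by
    have := abs_add_le (m t 2) ε'; rw [abs_of_pos hε'0] at this; linarith [hbd 2]
  have hM₀7 : (M₀ : ℝ) ≤ 7 := by
    have h1 : ⌈|m t 0 + ε'|⌉₊ ≤ 3 := Nat.ceil_le.2 (by push_cast; linarith)
    have h2 : ⌈|m t 1|⌉₊ ≤ 3 := Nat.ceil_le.2 (by push_cast; linarith)
    have : M₀ ≤ 7 := by omega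
    exact_mod_cast this
  have htK4 : 4 * t ≤ K := by linarith
  have mk : ∀ x : ℝ, |x| < 3 → ∀ n : ℕ, 1 ≤ n → -K < t * x - t / n ∧ t * x + t / n < K :=
    fun x hx n hn ↦ Rigidity.mark_ineq ht0 htK4 hx hn
  have hev : ∀ᶠ n : ℕ in atTop,
      bondDomainCrossingProb R (t / n) ≤
          μ.real (openCrossing halfPlane (arcA (m t 0) (m t 1) n)
            (rowIcc ⌊m t 2 * n⌋ ⌊m t 3 * n⌋)) ∧
        μ.real (openCrossing halfPlane (arcA (m t 0 + ε') (m t 1) n)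
            (rowIcc ⌊(m t 2 + ε') * n⌋ ⌊m t 3 * n⌋)) ≤
          bondDomainCrossingProb R (t / n) + C₀ * ((L : ℝ)⁻¹) ^ α := by
    filter_upwards [eventually_ge_atTop (⌈1 / ε'⌉₊ + 1)] with n hn
    have hn1 : 1 ≤ n := by omega
    have hn0 : 0 < n := hn1
    have hnr : (1 : ℝ) ≤ n := by exact_mod_cast hn1
    have hnpos : (0 : ℝ) < n := by linarith
    have hδ : 0 < t / n := div_pos ht0 hnpos
    have hδt : t / n ≤ t := div_le_self ht0.le hnr
    have hεn : 1 ≤ ε' * n := by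
      have h1 : (⌈1 / ε'⌉₊ : ℝ) + 1 ≤ n := by exact_mod_cast hn
      have h2 : 1 / ε' ≤ ⌈1 / ε'⌉₊ := Nat.le_ceil _
      have h3 : 1 / ε' ≤ n := by linarith
      rwa [div_le_iff₀ hε'0, mul_comm] at h3
    have hH2 : 2 * (t / n) < H := by linarith
    constructor
    · exact BoxExhaustion.bondDomainCrossingProb_box_le hK ht0 hn0 hm01.le hm23.le hH2
        (mk _ hb0 n hn1).1 (mk _ hb1 n hn1).2 (mk _ hb2 n hn1).1 (mk _ hb3 n hn1).2 R hRc hR0' hR2'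
    · have haε : m t 0 * n + 1 ≤ (m t 0 + ε') * n := by rw [add_mul]; linarith
      have hcε : m t 2 * n + 1 ≤ (m t 2 + ε') * n := by rw [add_mul]; linarith
      have hr : ∀ k : ℤ, ⌊(m t 0 + ε') * n⌋ ≤ k → k ≤ ⌊m t 1 * n⌋ → |k| ≤ ((M₀ * n : ℕ) : ℤ) := by
        intro k h1 h2
        have := BoxExhaustion.abs_le_of_floor_bounds hn1 h1 h2
        rw [hM₀]; push_cast at this ⊢; linarith
      have hrR : M₀ * n ≤ M₀ * n * L := Nat.le_mul_of_pos_right _ (by omega)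
      have hgeo : t / n * ((M₀ * n * L : ℕ) + 1) < min K H := by
        have e : t / n * ((M₀ * n * L : ℕ) + 1) = t * L * M₀ + t / n := by
          push_cast
          field_simp
        rw [e, htL]
        have h7 : κ * M₀ ≤ κ * 7 := mul_le_mul_of_nonneg_left hM₀7 hκ0.le
        have : t / n ≤ κ := hδt.trans htκ
        linarith
      have hup := BoxExhaustion.measureReal_openCrossing_halfPlane_le hK ht0 hn0 haε hcε hH2.le
        (by linarith [(mk _ hb0 n hn1).1]) (mk _ hb1 n hn1).2.le (by linarith [(mk _ hb2 n hn1).1])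
        (mk _ hb3 n hn1).2.le hr hrR hgeo R hRc hR0' hR2'
      have hescL := BoxExhaustion.escape_le hesc hM₀1 hn1 hL
      linarith
  /- Step 6: pass to the limit along `θ` and combine. -/
  have hev' := hθ.tendsto_atTop.eventually hev
  have hlow : f (crossRatio p) ≤ G (m t 0) (m t 1) (m t 2) (m t 3) :=
    le_of_tendsto_of_tendsto hboxlim hPlo (hev'.mono fun n hn ↦ hn.1)
  have hhigh : G (m t 0 + ε') (m t 1) (m t 2 + ε') (m t 3) ≤
      f (crossRatio p) + C₀ * ((L : ℝ)⁻¹) ^ α :=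
    le_of_tendsto_of_tendsto hPhi (hboxlim.add_const _) (hev'.mono fun n hn ↦ hn.2)
  rw [abs_lt] at hGlo hGhi
  rw [abs_le]
  constructor <;> linarith [hGlo.1, hGlo.2, hGhi.1, hGhi.2]

end Limit

/-- The gap parameter `g(x) = (1 − √x)/(4(1 + √x))` lies in `(0, 1/4)` for `x ∈ (0,1)` and the
symmetric tuple `(−1/4, −g, g, 1/4)` has cross-ratio `x`. [folklore] -/
theorem gap_mem_Ioo_and_crossRatio {x : ℝ} (hx : x ∈ Ioo (0 : ℝ) 1) :
    (1 - Real.sqrt x) / (4 * (1 + Real.sqrt x)) ∈ Ioo (0 : ℝ) (1 / 4) ∧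
      crossRatio ![-(1 / 4), -((1 - Real.sqrt x) / (4 * (1 + Real.sqrt x))),
        (1 - Real.sqrt x) / (4 * (1 + Real.sqrt x)), 1 / 4] = x := by
  set r := Real.sqrt x with hr
  have hr0 : 0 < r := Real.sqrt_pos.2 hx.1
  have hr1 : r < 1 := by rw [hr, Real.sqrt_lt' one_pos]; simpa using hx.2
  refine ⟨⟨div_pos (by linarith) (by linarith), ?_⟩, ?_⟩
  · rw [div_lt_iff₀ (by linarith)]; linarith
  · rw [Rigidity.crossRatio_symm]
    have e : (1 / 4 - (1 - r) / (4 * (1 + r))) / (1 / 4 + (1 - r) / (4 * (1 + r))) = r := by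
      have : (1 + r) ≠ 0 := by linarith
      field_simp
      ring
    rw [e, hr, Real.sq_sqrt hx.1.le]

end KernelFacts

open KernelFacts in
/-- **Kernel facts** (registered stub `stub_kernelFacts` of line `crossing_martingale`): a function
`f` that is a crossing limit of bond-`ℤ²` for every conformal rectangle is continuous on `(0,1)`
with boundary values `f(0⁺) = 0`, `f(1⁻) = 1` (RSW: box exhaustion against joint subsequential
limits of the half-plane crossing function, small-source decay and gap closing). [folklore] -/
theorem stub_kernelFacts : ∀ f : ℝ → ℝ, AllRectangleKernel f → ContinuousOn f (Ioo 0 1) ∧ Tendsto f (𝓝[>] 0) (𝓝 0) ∧ Tendsto f (𝓝[<] 1) (𝓝 1) := by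
  intro f hf
  obtain ⟨θ, hθ, G, hG⟩ := Subseq.exists_jointSubseqLimit id strictMono_id
  have hG' : ∀ a b c y : ℝ, a < b → b < c → c < y →
      Tendsto (fun n ↦ μ.real (openCrossing halfPlane (arcA a b (θ n))
        (rowIcc ⌊c * (θ n : ℕ)⌋ ⌊y * (θ n : ℕ)⌋))) atTop (𝓝 (G a b c y)) := hG
  set g : ℝ → ℝ := fun x ↦ (1 - Real.sqrt x) / (4 * (1 + Real.sqrt x)) with hg
  have hgc : Continuous g := by
    rw [hg]
    refine Continuous.div (by fun_prop) (by fun_prop) fun x ↦ ?_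
    have := Real.sqrt_nonneg x
    positivity
  have hg_mem : ∀ x ∈ Ioo (0 : ℝ) 1, g x ∈ Ioo (0 : ℝ) (1 / 4) := fun x hx ↦
    (gap_mem_Ioo_and_crossRatio hx).1
  -- the identification `f = G(−1/4, −g, g, 1/4)` on `(0,1)`
  have key : EqOn f (fun x ↦ G (-(1 / 4)) (-g x) (g x) (1 / 4)) (Ioo 0 1) := by
    intro x hx
    obtain ⟨⟨hg0, hg4⟩, hcr⟩ := gap_mem_Ioo_and_crossRatio hx
    have hmono : StrictMono (![-(1 / 4), -g x, g x, 1 / 4] : Fin 4 → ℝ) :=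
      BoxExhaustion.strictMono_marks (by simp only [hg]; linarith) (by simp only [hg]; linarith)
        (by simp only [hg]; linarith)
    have habs : ∀ i, |(![-(1 / 4), -g x, g x, 1 / 4] : Fin 4 → ℝ) i| ≤ 1 / 4 := by
      intro i
      have h0 : 0 < g x := hg0
      have h4 : g x < 1 / 4 := hg4
      fin_cases i <;> simp [abs_le] <;> constructor <;> linarith
    have := apply_crossRatio_eq hG' hθ hf hmono habs
    simp only [Matrix.cons_val_zero, Matrix.cons_val_one, Matrix.cons_val] at this
    show f x = G (-(1 / 4)) (-g x) (g x) (1 / 4)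
    rw [← this]
    exact congrArg f hcr.symm
  refine ⟨?_, ?_, ?_⟩
  · -- continuity on `(0,1)`
    have hcont := Subseq.continuousOn_of_jointLimit hG' hθ
    have hmap : Continuous fun x : ℝ ↦ ((-(1 / 4) : ℝ), -g x, g x, (1 / 4 : ℝ)) := by fun_prop
    refine (hcont.comp hmap.continuousOn fun x hx ↦ ?_).congr key
    obtain ⟨h0, h4⟩ := hg_mem x hx
    exact ⟨by simp only; linarith, by simp only; linarith, by simp only; linarith⟩
  · -- `f(0⁺) = 0`
    obtain ⟨C, α, -, hα, hesc⟩ := exists_real_boxToFar_le_rpow_of_le_half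
    have hg0 : Tendsto g (𝓝[>] 0) (𝓝 (1 / 4)) := by
      have : g 0 = 1 / 4 := by simp [hg]
      exact (hgc.tendsto' 0 (1 / 4) this).mono_left nhdsWithin_le_nhds
    have hbound : Tendsto (fun x ↦ C * ((-g x - -(1 / 4)) / (g x - -(1 / 4))) ^ α) (𝓝[>] 0)
        (𝓝 0) := by
      have h2 : Tendsto (fun x ↦ (-g x - -(1 / 4)) / (g x - -(1 / 4))) (𝓝[>] 0)
          (𝓝 ((-(1 / 4) - -(1 / 4)) / (1 / 4 - -(1 / 4)))) :=
        (hg0.neg.sub tendsto_const_nhds).div (hg0.sub tendsto_const_nhds) (by norm_num)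
      rw [show ((-(1 / 4) : ℝ) - -(1 / 4)) / (1 / 4 - -(1 / 4)) = 0 by norm_num] at h2
      have h3 := h2.rpow_const (p := α) (Or.inr hα.le)
      rw [Real.zero_rpow hα.ne'] at h3
      simpa using h3.const_mul C
    refine tendsto_of_tendsto_of_tendsto_of_le_of_le' tendsto_const_nhds hbound ?_ ?_
    · filter_upwards [Ioo_mem_nhdsGT one_pos] with x hx
      rw [key hx]
      obtain ⟨h0, h4⟩ := hg_mem x hx
      exact (Subseq.jointLimit_mem_Icc hG' (by linarith) (by linarith) (by linarith)).1
    · filter_upwards [Ioo_mem_nhdsGT one_pos] with x hx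
      rw [key hx]
      obtain ⟨h0, h4⟩ := hg_mem x hx
      exact Subseq.jointLimit_le_small_source hG' hθ hα hesc (by linarith) (by linarith)
        (by linarith)
  · -- `f(1⁻) = 1`
    have hg1 : Tendsto g (𝓝[<] 1) (𝓝 0) := by
      have : g 1 = 0 := by simp [hg]
      exact (hgc.tendsto' 1 0 this).mono_left nhdsWithin_le_nhds
    have h2g : Tendsto (fun x ↦ 2 * g x) (𝓝[<] 1) (𝓝[>] 0) := by
      refine tendsto_nhdsWithin_iff.2 ⟨by simpa using hg1.const_mul 2, ?_⟩
      filter_upwards [Ioo_mem_nhdsLT one_pos] with x hx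
      exact mem_Ioi.2 (by linarith [(hg_mem x hx).1])
    have hlow : Tendsto (fun x ↦ G (-(1 / 8)) 0 (2 * g x) (1 / 4)) (𝓝[<] 1) (𝓝 1) :=
      (GapClose.stub_jointLimit_tendsto_one hG' hθ (a := -(1 / 8)) (b := 0) (y := 1 / 4)
        (by norm_num) (by norm_num)).comp h2g
    have hsmall : ∀ᶠ x in 𝓝[<] (1 : ℝ), g x < 1 / 8 :=
      hg1 (Iio_mem_nhds (by norm_num))
    refine tendsto_of_tendsto_of_tendsto_of_le_of_le' hlow tendsto_const_nhds ?_ ?_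
    · filter_upwards [Ioo_mem_nhdsLT one_pos, hsmall] with x hx hx8
      rw [key hx]
      obtain ⟨h0, h4⟩ := hg_mem x hx
      have htr := Subseq.translate_of_jointLimit hG' hθ (a := -(1 / 4)) (b := -g x) (c := g x)
        (y := 1 / 4) (by linarith) (by linarith) (by linarith) (g x)
      simp only
      rw [← htr]
      exact Subseq.jointLimit_mono hG' (by linarith) (by linarith) (by linarith) (by linarith)
        (by norm_num) (by linarith) (by linarith) (by linarith)
    · filter_upwards [Ioo_mem_nhdsLT one_pos] with x hx
      rw [key hx]
      obtain ⟨h0, h4⟩ := hg_mem x hx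
      exact (Subseq.jointLimit_mem_Icc hG' (by linarith) (by linarith) (by linarith)).2

end Summit.CriticalPhenomena.CardyFormulaZ2.Cruxes.CardyRigidity.CrossingMartingale

end
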